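import Mathlib
import Summits.CriticalPhenomena.CardyFormulaZ2.Theorems.CardySelfRefinementDefs
import Summits.CriticalPhenomena.CardyFormulaZ2.Theorems.CardySelfRefinementGradientComparabilityStubCornerWindowsDefectZero
import HarnessLib

/-!
# Crux `GradientComparability` (stmt-CriticalPhenomena-10269), line `monotone-product-coordinates` —
# support for stub `stub_cornerWindows`, part 5: hypothesis (D0) reduced to its boundary layer

Route `CardySelfRefinement`, sub-problem `CriticalPhenomena/CardyFormulaZ2`; vocabulary from
`CardySelfRefinementDefs` (`ax tb M Aloc P window coinWindow edgeOf`); the canonical enumeration of a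
bundle and the assembly of part 3 (`…StubCornerWindowsDefect`: `bundle_param_canonical`,
`cornerWindow_c0_of_pivotalWindow_of_defectBound : (K0) → (D0) → h0`); brick S2 of part 4
(`…StubCornerWindowsDefectZero`: `real_section_sdiff_eq_zero_of_far_c0`, the proper-pattern defect
of a far bundle vanishes on the slice `c = 0`).

## Mathematics

Notation of part 3: for a selector coin `i = (t, d, 2)` of the coin window `K`, `B_i` is its bundle
(the `k` axial sub-edges `e_j = edgeOf (k•t + j e_d, d)`, `j < k`, canonical enumeration),
`A_i^J = {ω | (ω ∖ B_i) ∪ {e_j | j ∈ J} ∈ Aloc}` (`J ⊆ [k]`) its sections,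
`Piv_i = {ω ∪ B_i ∈ Aloc, ω ∖ B_i ∉ Aloc}` its set-pivotality; `N = Σ_i M(Piv_i)`,
`T = Σ_i Σ_{J ⊆ [k]} M(A_i^J ∖ A_i^∅)`, and hypothesis (D0) of the assembly reads
`2^{-k} T ≤ θ N`, `θ < ½`, at the band points of the slice `c = 0` and at the corner `(1, 0)`.

Two elementary facts about one bundle, valid for every `M = M_k(ρ,c)`: the top pattern term IS
the pivotality, `A_i^{[k]} ∖ A_i^∅ = Piv_i` (`real_section_sdiff_top_eq_pivotal`), and every
pattern term lies below it, `A_i^J ∖ A_i^∅ ⊆ Piv_i` (`Aloc` is increasing;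
`real_section_sdiff_le_pivotal`), the empty pattern contributing `0`.  Hence, bundle by bundle,
`T = N + T′` with the PROPER-pattern defect `T′ = Σ_i Σ_{J ⊊ [k]} M(A_i^J ∖ A_i^∅)`, and
`T′_S ≤ (2^k − 2) N_S` for every set `S` of bundles (`sum_erase_real_section_sdiff_le`).

Call the selector `i` NEAR if one of the `k + 1` canonical vertices `k•t + j e_d` (`j ≤ k`) of its
bundle is at drawn distance `< 2η` from a side of a quad, FAR otherwise (the radius `r = 2η` of S2).
By S2 the proper pattern terms of a far bundle vanish on `{c = 0}` (any real `ρ`, the corner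
included), so there `T′ = T′_near` and

  `2^{-k} T = 2^{-k} N + 2^{-k} T′_near`                    (`sum_sum_powerset_eq_of_far_c0`).

Consequently (D0) is EQUIVALENT to its boundary-layer form
(D0∂) `2^{-k} T′_near ≤ θ′ N` with `θ′ < ½ − 2^{-k}`, at the band points and at the corner
(`defectBound_c0_of_boundaryDefectBound`, registered, with `θ = θ′ + 2^{-k}`; converse
`boundaryDefectBound_c0_of_defectBound` with `θ′ = θ − 2^{-k}`), and (D0∂) follows from the pure
pivotal-count statement
(D0π) `N_near ≤ θ″ N` with `θ″ < ½`: the near bundles carry less than half of the pivotal mass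
(`boundaryDefectBound_c0_of_boundaryPivotalBound`, registered, `θ′ = (1 − 2^{1−k}) θ″₊`, which is
`< ½ − 2^{-k}` exactly when `θ″₊ < ½`).  In the statements the layer is any finite set `S` of near
selector coins of the window (all terms are nonnegative, so the largest such `S` is the binding
one).  Pure bookkeeping on top of S2; no percolation estimate and no named fact is used.
-/

noncomputable section

namespace Summit.CriticalPhenomena.CardyFormulaZ2.Theorems.CardySelfRefinement

open scoped Topology
open Filter Set MeasureTheory
open Literature.Probability.LatticeModels Literature.Probability.Percolation
open Literature.Probability.Percolation.QuadCrossing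
open Summit.CriticalPhenomena.CardyFormulaZ2.Theses.CardySelfRefinement

/-! ## One bundle: the top pattern term is the pivotality, every pattern term lies below it -/

/-- For the canonical enumeration of the bundle `(t, d)`, the top section difference is the
set-pivotality of the bundle: `M(A^{[k]} ∖ A^∅) = M(ω ∪ B ∈ Aloc ∧ ω ∖ B ∉ Aloc)`, any `M_k(ρ,c)`. -/
theorem real_section_sdiff_top_eq_pivotal {k : ℕ} (hk : 0 < k) (m : ℕ)
    (F : Fin m → Quad (Set.univ : Set ℂ)) (η ρ c : ℝ) (t : Site 2) (d : Fin 2) :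
    (M k ρ c).real ({ω | ω \ edgeOf '' {vd : Site 2 × Fin 2 | ax k vd ∧ tb k vd = t ∧ vd.2 = d} ∪
        ↑((Finset.range k).image fun j : ℕ =>
          edgeOf ((fun l => (k : ℤ) * t l + if l = d then (j : ℤ) else 0), d)) ∈ Aloc m F η} \
      {ω | ω \ edgeOf '' {vd : Site 2 × Fin 2 | ax k vd ∧ tb k vd = t ∧ vd.2 = d} ∈ Aloc m F η}) =
    (M k ρ c).real {ω | ω ∪ edgeOf '' {vd : Site 2 × Fin 2 | ax k vd ∧ tb k vd = t ∧ vd.2 = d} ∈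
        Aloc m F η ∧ ω \ edgeOf '' {vd : Site 2 × Fin 2 | ax k vd ∧ tb k vd = t ∧ vd.2 = d} ∉
        Aloc m F η} := by
  obtain ⟨hw₁, hw₂, -⟩ := bundle_param_canonical hk t d
  rw [← coe_bundleFinset_eq_image k (w := fun j l => (k : ℤ) * t l + if l = d then (j : ℤ) else 0)
    hw₁ hw₂ rfl]
  simp only [Set.sdiff_union_self]
  rfl

/-- Every section difference of the bundle lies in its set-pivotality event (`Aloc` is increasing):
`M(A^J ∖ A^∅) ≤ M(ω ∪ B ∈ Aloc ∧ ω ∖ B ∉ Aloc)` for `J ⊆ [k]`, any `M_k(ρ,c)`. -/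
theorem real_section_sdiff_le_pivotal {k : ℕ} (hk : 0 < k) (m : ℕ)
    (F : Fin m → Quad (Set.univ : Set ℂ)) (η ρ c : ℝ) (t : Site 2) (d : Fin 2) {J : Finset ℕ}
    (hJ : J ∈ (Finset.range k).powerset) :
    (M k ρ c).real ({ω | ω \ edgeOf '' {vd : Site 2 × Fin 2 | ax k vd ∧ tb k vd = t ∧ vd.2 = d} ∪
        ↑(J.image fun j : ℕ =>
          edgeOf ((fun l => (k : ℤ) * t l + if l = d then (j : ℤ) else 0), d)) ∈ Aloc m F η} \
      {ω | ω \ edgeOf '' {vd : Site 2 × Fin 2 | ax k vd ∧ tb k vd = t ∧ vd.2 = d} ∈ Aloc m F η}) ≤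
    (M k ρ c).real {ω | ω ∪ edgeOf '' {vd : Site 2 × Fin 2 | ax k vd ∧ tb k vd = t ∧ vd.2 = d} ∈
        Aloc m F η ∧ ω \ edgeOf '' {vd : Site 2 × Fin 2 | ax k vd ∧ tb k vd = t ∧ vd.2 = d} ∉
        Aloc m F η} := by
  haveI := isProbabilityMeasure_M k ρ c
  have hA := isUpperSet_Aloc m F η
  obtain ⟨hw₁, hw₂, -⟩ := bundle_param_canonical hk t d
  rw [← coe_bundleFinset_eq_image k (w := fun j l => (k : ℤ) * t l + if l = d then (j : ℤ) else 0)
    hw₁ hw₂ rfl]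
  refine measureReal_mono ?_
  rintro ω ⟨h1, h2⟩
  refine ⟨hA ?_ h1, h2⟩
  refine Set.union_subset (Set.sdiff_subset.trans Set.subset_union_left)
    (Set.Subset.trans ?_ Set.subset_union_right)
  rw [Finset.coe_image, Finset.coe_image]
  exact Set.image_mono (Finset.coe_subset.2 (Finset.mem_powerset.1 hJ))

/-- The pattern sum of one bundle splits off its top term:
`Σ_{J ⊆ [k]} M(A^J ∖ A^∅) = M(B set-pivotal) + Σ_{J ⊊ [k]} M(A^J ∖ A^∅)`, any `M_k(ρ,c)`. -/
theorem sum_powerset_real_section_sdiff_eq {k : ℕ} (hk : 0 < k) (m : ℕ)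
    (F : Fin m → Quad (Set.univ : Set ℂ)) (η ρ c : ℝ) (t : Site 2) (d : Fin 2) :
    ∑ J ∈ (Finset.range k).powerset, (M k ρ c).real ({ω | ω \ edgeOf '' {vd : Site 2 × Fin 2 |
        ax k vd ∧ tb k vd = t ∧ vd.2 = d} ∪ ↑(J.image fun j : ℕ =>
          edgeOf ((fun l => (k : ℤ) * t l + if l = d then (j : ℤ) else 0), d)) ∈ Aloc m F η} \
      {ω | ω \ edgeOf '' {vd : Site 2 × Fin 2 | ax k vd ∧ tb k vd = t ∧ vd.2 = d} ∈ Aloc m F η}) =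
    (M k ρ c).real {ω | ω ∪ edgeOf '' {vd : Site 2 × Fin 2 | ax k vd ∧ tb k vd = t ∧ vd.2 = d} ∈
        Aloc m F η ∧ ω \ edgeOf '' {vd : Site 2 × Fin 2 | ax k vd ∧ tb k vd = t ∧ vd.2 = d} ∉
        Aloc m F η} +
      ∑ J ∈ ((Finset.range k).powerset).erase (Finset.range k), (M k ρ c).real ({ω | ω \ edgeOf ''
        {vd : Site 2 × Fin 2 | ax k vd ∧ tb k vd = t ∧ vd.2 = d} ∪ ↑(J.image fun j : ℕ =>
          edgeOf ((fun l => (k : ℤ) * t l + if l = d then (j : ℤ) else 0), d)) ∈ Aloc m F η} \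
      {ω | ω \ edgeOf '' {vd : Site 2 × Fin 2 | ax k vd ∧ tb k vd = t ∧ vd.2 = d} ∈ Aloc m F η}) := by
  classical
  rw [← Finset.add_sum_erase _ _ (Finset.mem_powerset.2 subset_rfl :
    Finset.range k ∈ (Finset.range k).powerset)]
  congr 1
  exact real_section_sdiff_top_eq_pivotal hk m F η ρ c t d

/-- The proper-pattern defect of one bundle is at most `(2^k − 2)` times its pivotality (the empty
pattern contributes `0`, each of the `2^k − 2` others at most `M(B set-pivotal)`), any `M_k(ρ,c)`. -/
theorem sum_erase_real_section_sdiff_le {k : ℕ} (hk : 0 < k) (m : ℕ)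
    (F : Fin m → Quad (Set.univ : Set ℂ)) (η ρ c : ℝ) (t : Site 2) (d : Fin 2) :
    ∑ J ∈ ((Finset.range k).powerset).erase (Finset.range k), (M k ρ c).real ({ω | ω \ edgeOf ''
        {vd : Site 2 × Fin 2 | ax k vd ∧ tb k vd = t ∧ vd.2 = d} ∪ ↑(J.image fun j : ℕ =>
          edgeOf ((fun l => (k : ℤ) * t l + if l = d then (j : ℤ) else 0), d)) ∈ Aloc m F η} \
      {ω | ω \ edgeOf '' {vd : Site 2 × Fin 2 | ax k vd ∧ tb k vd = t ∧ vd.2 = d} ∈ Aloc m F η}) ≤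
    (2 ^ k - 2) * (M k ρ c).real {ω | ω ∪ edgeOf '' {vd : Site 2 × Fin 2 | ax k vd ∧ tb k vd = t ∧
        vd.2 = d} ∈ Aloc m F η ∧ ω \ edgeOf '' {vd : Site 2 × Fin 2 | ax k vd ∧ tb k vd = t ∧
        vd.2 = d} ∉ Aloc m F η} := by
  classical
  have hne : (∅ : Finset ℕ) ≠ Finset.range k := fun h => by
    have h' := congrArg Finset.card h
    rw [Finset.card_empty, Finset.card_range] at h'
    omega
  have h0 : (∅ : Finset ℕ) ∈ ((Finset.range k).powerset).erase (Finset.range k) :=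
    Finset.mem_erase.2 ⟨hne, Finset.empty_mem_powerset _⟩
  have hcard : ((((Finset.range k).powerset).erase (Finset.range k)).erase ∅).card = 2 ^ k - 2 := by
    rw [Finset.card_erase_of_mem h0, Finset.card_erase_of_mem (Finset.mem_powerset.2 subset_rfl),
      Finset.card_powerset, Finset.card_range, Nat.sub_sub]
  have h2k : 2 ≤ 2 ^ k := Nat.le_self_pow hk.ne' 2
  rw [← Finset.add_sum_erase _ _ h0]
  simp only [Finset.image_empty, Finset.coe_empty, Set.union_empty, Set.sdiff_self, measureReal_empty,
    zero_add]
  refine (Finset.sum_le_card_nsmul _ _ _ fun J hJ => real_section_sdiff_le_pivotal hk m F η ρ c t d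
    (Finset.mem_of_mem_erase (Finset.mem_of_mem_erase hJ))).trans (le_of_eq ?_)
  rw [hcard, nsmul_eq_mul, Nat.cast_sub h2k]
  push_cast
  ring

/-! ## The window: `T = N + T′`, and on `{c = 0}` the far part of `T′` vanishes -/

/-- Summed over a finite set `T` of selector coins: `Σ_T Σ_{J ⊆ [k]} = Σ_T M(Piv) + Σ_T Σ_{J ⊊ [k]}`,
any `M_k(ρ,c)`. -/
theorem sum_sum_powerset_eq_pivotal_add_proper {k : ℕ} (hk : 0 < k) (m : ℕ)
    (F : Fin m → Quad (Set.univ : Set ℂ)) (η ρ c : ℝ) (T : Finset (Site 2 × Fin 2 × Fin 3)) :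
    ∑ i ∈ T, ∑ J ∈ (Finset.range k).powerset, (M k ρ c).real ({ω | ω \ edgeOf '' {vd : Site 2 × Fin 2 |
        ax k vd ∧ tb k vd = i.1 ∧ vd.2 = i.2.1} ∪ ↑(J.image fun j : ℕ =>
          edgeOf ((fun l => (k : ℤ) * i.1 l + if l = i.2.1 then (j : ℤ) else 0), i.2.1)) ∈ Aloc m F η} \
      {ω | ω \ edgeOf '' {vd : Site 2 × Fin 2 | ax k vd ∧ tb k vd = i.1 ∧ vd.2 = i.2.1} ∈ Aloc m F η}) =
    ∑ i ∈ T, (M k ρ c).real {ω | ω ∪ edgeOf '' {vd : Site 2 × Fin 2 | ax k vd ∧ tb k vd = i.1 ∧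
        vd.2 = i.2.1} ∈ Aloc m F η ∧ ω \ edgeOf '' {vd : Site 2 × Fin 2 | ax k vd ∧ tb k vd = i.1 ∧
        vd.2 = i.2.1} ∉ Aloc m F η} +
      ∑ i ∈ T, ∑ J ∈ ((Finset.range k).powerset).erase (Finset.range k), (M k ρ c).real ({ω | ω \
        edgeOf '' {vd : Site 2 × Fin 2 | ax k vd ∧ tb k vd = i.1 ∧ vd.2 = i.2.1} ∪ ↑(J.image fun j : ℕ =>
          edgeOf ((fun l => (k : ℤ) * i.1 l + if l = i.2.1 then (j : ℤ) else 0), i.2.1)) ∈ Aloc m F η} \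
      {ω | ω \ edgeOf '' {vd : Site 2 × Fin 2 | ax k vd ∧ tb k vd = i.1 ∧ vd.2 = i.2.1} ∈ Aloc m F η}) := by
  rw [← Finset.sum_add_distrib]
  exact Finset.sum_congr rfl fun i _ => sum_powerset_real_section_sdiff_eq hk m F η ρ c i.1 i.2.1

/-- **On `{c = 0}` the defect splits into the pivotal count and the proper defect of the layer.**
For `0 < k`, `0 < η`, any real `ρ`, a finite set `T` of selector coins and `S ⊆ T` containing every
coin of `T` that is not far (far: all `k + 1` canonical bundle vertices at drawn distance `≥ 2η` from
every side of every quad): `Σ_T Σ_{J ⊆ [k]} M_k(ρ,0)(A^J ∖ A^∅) = Σ_T M_k(ρ,0)(Piv) + Σ_S Σ_{J ⊊ [k]}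
M_k(ρ,0)(A^J ∖ A^∅)` — the proper terms of the far bundles vanish by S2. -/
theorem sum_sum_powerset_eq_of_far_c0 {k m : ℕ} (hk : 0 < k) (F : Fin m → Quad (Set.univ : Set ℂ))
    {η : ℝ} (hη : 0 < η) (ρ : ℝ) {T S : Finset (Site 2 × Fin 2 × Fin 3)} (hS : S ⊆ T)
    (hfar : ∀ i ∈ T, i ∉ S → ∀ j : ℕ, j ≤ k → ∀ (a : Fin m) (b : Fin 4), ∀ q ∈ (F a).side b,
      2 * η ≤ dist ((η : ℂ) * squareLatticeEmbedding.z
        (fun l => (k : ℤ) * i.1 l + if l = i.2.1 then (j : ℤ) else 0)) q) :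
    ∑ i ∈ T, ∑ J ∈ (Finset.range k).powerset, (M k ρ 0).real ({ω | ω \ edgeOf '' {vd : Site 2 × Fin 2 |
        ax k vd ∧ tb k vd = i.1 ∧ vd.2 = i.2.1} ∪ ↑(J.image fun j : ℕ =>
          edgeOf ((fun l => (k : ℤ) * i.1 l + if l = i.2.1 then (j : ℤ) else 0), i.2.1)) ∈ Aloc m F η} \
      {ω | ω \ edgeOf '' {vd : Site 2 × Fin 2 | ax k vd ∧ tb k vd = i.1 ∧ vd.2 = i.2.1} ∈ Aloc m F η}) =
    ∑ i ∈ T, (M k ρ 0).real {ω | ω ∪ edgeOf '' {vd : Site 2 × Fin 2 | ax k vd ∧ tb k vd = i.1 ∧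
        vd.2 = i.2.1} ∈ Aloc m F η ∧ ω \ edgeOf '' {vd : Site 2 × Fin 2 | ax k vd ∧ tb k vd = i.1 ∧
        vd.2 = i.2.1} ∉ Aloc m F η} +
      ∑ i ∈ S, ∑ J ∈ ((Finset.range k).powerset).erase (Finset.range k), (M k ρ 0).real ({ω | ω \
        edgeOf '' {vd : Site 2 × Fin 2 | ax k vd ∧ tb k vd = i.1 ∧ vd.2 = i.2.1} ∪ ↑(J.image fun j : ℕ =>
          edgeOf ((fun l => (k : ℤ) * i.1 l + if l = i.2.1 then (j : ℤ) else 0), i.2.1)) ∈ Aloc m F η} \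
      {ω | ω \ edgeOf '' {vd : Site 2 × Fin 2 | ax k vd ∧ tb k vd = i.1 ∧ vd.2 = i.2.1} ∈ Aloc m F η}) := by
  rw [sum_sum_powerset_eq_pivotal_add_proper hk m F η ρ 0 T, Finset.sum_subset hS fun i hi hiS =>
    Finset.sum_eq_zero fun J hJ => real_section_sdiff_eq_zero_of_far_c0 k m F hη le_rfl ρ i.1 i.2.1
      (hfar i hi hiS) J (Finset.mem_of_mem_erase hJ) (Finset.ne_of_mem_erase hJ)]

/-! ## The three reductions -/

/-- **(D0π) ⟹ (D0∂)** (registered helper of `stub_cornerWindows`): if on the slice `c = 0` the near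
bundles (a canonical vertex within drawn distance `2η` of a side of a quad) carry at most the fraction
`θ″ < ½` of the pivotal count `N`, at the band points and at the corner `(1,0)`, then their proper-pattern
defect satisfies `2^{-k} T′_near ≤ θ′ N` with `θ′ = (1 − 2^{1−k}) θ″₊ < ½ − 2^{-k}` (each proper pattern
term is at most the pivotality, the empty one is `0`).  Valid verbatim for any `M_k(ρ,c)`; stated on the
slice. -/
theorem boundaryDefectBound_c0_of_boundaryPivotalBound : (∀ k : ℕ, k = 2 ∨ k = 3 → ∀ (m : ℕ) (F : Fin m → Quad (Set.univ : Set ℂ)), 0 < m → ∀ vlo vhi : ℝ, 0 < vlo → vlo < vhi → vhi < 1 → ∃ θ η₁ : ℝ, θ < 1 / 2 ∧ 0 < η₁ ∧ ∀ η ∈ Set.Ioo 0 η₁, ∀ K : Finset (Site 2 × Fin 2 × Fin 3), (↑K : Set (Site 2 × Fin 2 × Fin 3)) = coinWindow k (window m F η) → ∀ S : Finset (Site 2 × Fin 2 × Fin 3), S ⊆ K.filter (fun i => i.2.2 = 2) → (∀ i ∈ S, ∃ j : ℕ, j ≤ k ∧ ∃ (a : Fin m) (b : Fin 4), ∃ q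 ∈ (F a).side b, dist ((η : ℂ) * squareLatticeEmbedding.z (fun l => (k : ℤ) * i.1 l + if l = i.2.1 then (j : ℤ) else 0)) q < 2 * η) → (∀ ρ ∈ Set.Icc (0 : ℝ) 1, P k m F η ρ 0 ∈ Set.Icc vlo vhi → ∑ i ∈ S, (M k ρ 0).real {ω | ω ∪ edgeOf '' {vd : Site 2 × Fin 2 | ax k vd ∧ tb k vd = i.1 ∧ vd.2 = i.2.1} ∈ Aloc m F η ∧ ω \ edgeOf '' {vd : Site 2 × Fin 2 | ax k vd ∧ tb k vd = i.1 ∧ vd.2 = i.2.1} ∉ Aloc m F η} ≤ θ * ∑ i ∈ K with i.2.2 = 2, (M k ρ 0).real {ω | ω ∪ edgeOf '' {vd : Site 2 × Fin 2 | ax k vd ∧ tb k vd = i.1 ∧ vd.2 = i.2.1} ∈ Aloc m F η ∧ ω \ edgeOf '' {vd : Site 2 × Fin 2 | ax k vd ∧ tb k vd = i.1 ∧ vd.2 = i.2.1} ∉ Aloc m F η}) ∧ ∑ i ∈ S, (M k 1 0).real {ω | ω ∪ edgeOf '' {vd : Site 2 × Fin 2 | ax k vd ∧ tb k vd = i.1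 ∧ vd.2 = i.2.1} ∈ Aloc m F η ∧ ω \ edgeOf '' {vd : Site 2 × Fin 2 | ax k vd ∧ tb k vd = i.1 ∧ vd.2 = i.2.1} ∉ Aloc m F η} ≤ θ * ∑ i ∈ K with i.2.2 = 2, (M k 1 0).real {ω | ω ∪ edgeOf '' {vd : Site 2 × Fin 2 | ax k vd ∧ tb k vd = i.1 ∧ vd.2 = i.2.1} ∈ Aloc m F η ∧ ω \ edgeOf '' {vd : Site 2 × Fin 2 | ax k vd ∧ tb k vd = i.1 ∧ vd.2 = i.2.1} ∉ Aloc m F η}) → ∀ k : ℕ, k = 2 ∨ k = 3 → ∀ (m : ℕ) (F : Fin m → Quad (Set.univ : Set ℂ)), 0 < m → ∀ vlo vhi : ℝ, 0 < vlo → vlo < vhi → vhi < 1 → ∃ θ η₁ : ℝ, θ < 1 / 2 - (1 / 2) ^ k ∧ 0 < η₁ ∧ ∀ η ∈ Set.Ioo 0 η₁, ∀ K : Finset (Site 2 × Fin 2 × Fin 3), (↑K : Set (Site 2 × Fin 2 × Fin 3)) = coinWindow k (window m F η) → ∀ S : Finset (Site 2 × Fin 2 × Fin 3), S ⊆ K.filter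 (fun i => i.2.2 = 2) → (∀ i ∈ S, ∃ j : ℕ, j ≤ k ∧ ∃ (a : Fin m) (b : Fin 4), ∃ q ∈ (F a).side b, dist ((η : ℂ) * squareLatticeEmbedding.z (fun l => (k : ℤ) * i.1 l + if l = i.2.1 then (j : ℤ) else 0)) q < 2 * η) → (∀ ρ ∈ Set.Icc (0 : ℝ) 1, P k m F η ρ 0 ∈ Set.Icc vlo vhi → (1 / 2) ^ k * ∑ i ∈ S, ∑ J ∈ ((Finset.range k).powerset).erase (Finset.range k), (M k ρ 0).real ({ω | ω \ edgeOf '' {vd : Site 2 × Fin 2 | ax k vd ∧ tb k vd = i.1 ∧ vd.2 = i.2.1} ∪ ↑(J.image fun j : ℕ => edgeOf ((fun l => (k : ℤ) * i.1 l + if l = i.2.1 then (j : ℤ) else 0), i.2.1)) ∈ Aloc m F η} \ {ω | ω \ edgeOf '' {vd : Site 2 × Fin 2 | ax k vd ∧ tb k vd = i.1 ∧ vd.2 = i.2.1} ∈ Aloc m F η}) ≤ θ * ∑ i ∈ K with i.2.2 = 2, (M k ρ 0).real {ω | ω ∪ edgeOf '' {vd : Site 2 × Fin 2 | ax k vd ∧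 tb k vd = i.1 ∧ vd.2 = i.2.1} ∈ Aloc m F η ∧ ω \ edgeOf '' {vd : Site 2 × Fin 2 | ax k vd ∧ tb k vd = i.1 ∧ vd.2 = i.2.1} ∉ Aloc m F η}) ∧ (1 / 2) ^ k * ∑ i ∈ S, ∑ J ∈ ((Finset.range k).powerset).erase (Finset.range k), (M k 1 0).real ({ω | ω \ edgeOf '' {vd : Site 2 × Fin 2 | ax k vd ∧ tb k vd = i.1 ∧ vd.2 = i.2.1} ∪ ↑(J.image fun j : ℕ => edgeOf ((fun l => (k : ℤ) * i.1 l + if l = i.2.1 then (j : ℤ) else 0), i.2.1)) ∈ Aloc m F η} \ {ω | ω \ edgeOf '' {vd : Site 2 × Fin 2 | ax k vd ∧ tb k vd = i.1 ∧ vd.2 = i.2.1} ∈ Aloc m F η}) ≤ θ * ∑ i ∈ K with i.2.2 = 2, (M k 1 0).real {ω | ω ∪ edgeOf '' {vd : Site 2 × Fin 2 | ax k vd ∧ tb k vd = i.1 ∧ vd.2 = i.2.1} ∈ Aloc m F η ∧ ω \ edgeOf '' {vd : Site 2 × Fin 2 | ax k vd ∧ tb k vd = i.1 ∧ vd.2 =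 i.2.1} ∉ Aloc m F η} := by
  intro H k hk m F hm vlo vhi hvlo hvv hvhi
  have hkpos : 0 < k := by rcases hk with rfl | rfl <;> norm_num
  have hp4 : (1 / 2 : ℝ) ^ k ≤ 1 / 4 := by rcases hk with rfl | rfl <;> norm_num
  have hpk : (1 / 2 : ℝ) ^ k * (2 ^ k - 2) = 1 - 2 * (1 / 2) ^ k := by
    have h : (1 / 2 : ℝ) ^ k * 2 ^ k = 1 := by rw [← mul_pow]; norm_num
    linear_combination h
  obtain ⟨θ, η₁, hθ, hη₁, Hθ⟩ := H k hk m F hm vlo vhi hvlo hvv hvhi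
  have hθ' : max θ 0 < 1 / 2 := max_lt hθ (by norm_num)
  refine ⟨(1 - 2 * (1 / 2) ^ k) * max θ 0, η₁, ?_, hη₁, fun η hη K hK S hS hnear => ?_⟩
  · nlinarith [mul_pos (sub_pos.2 hθ') (by linarith : (0 : ℝ) < 1 - 2 * (1 / 2) ^ k)]
  obtain ⟨Hb, Hc⟩ := Hθ η hη K hK S hS hnear
  -- the real-inequality core, at one parameter point `(ρ, c)`
  have key : ∀ ρ c : ℝ, ∑ i ∈ S, (M k ρ c).real {ω | ω ∪ edgeOf '' {vd : Site 2 × Fin 2 | ax k vd ∧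
      tb k vd = i.1 ∧ vd.2 = i.2.1} ∈ Aloc m F η ∧ ω \ edgeOf '' {vd : Site 2 × Fin 2 | ax k vd ∧
      tb k vd = i.1 ∧ vd.2 = i.2.1} ∉ Aloc m F η} ≤ θ * ∑ i ∈ K with i.2.2 = 2, (M k ρ c).real {ω | ω ∪
      edgeOf '' {vd : Site 2 × Fin 2 | ax k vd ∧ tb k vd = i.1 ∧ vd.2 = i.2.1} ∈ Aloc m F η ∧ ω \
      edgeOf '' {vd : Site 2 × Fin 2 | ax k vd ∧ tb k vd = i.1 ∧ vd.2 = i.2.1} ∉ Aloc m F η} →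
      (1 / 2) ^ k * ∑ i ∈ S, ∑ J ∈ ((Finset.range k).powerset).erase (Finset.range k), (M k ρ c).real
        ({ω | ω \ edgeOf '' {vd : Site 2 × Fin 2 | ax k vd ∧ tb k vd = i.1 ∧ vd.2 = i.2.1} ∪
          ↑(J.image fun j : ℕ => edgeOf ((fun l => (k : ℤ) * i.1 l + if l = i.2.1 then (j : ℤ) else 0),
            i.2.1)) ∈ Aloc m F η} \ {ω | ω \ edgeOf '' {vd : Site 2 × Fin 2 | ax k vd ∧ tb k vd = i.1 ∧
          vd.2 = i.2.1} ∈ Aloc m F η}) ≤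
      (1 - 2 * (1 / 2) ^ k) * max θ 0 * ∑ i ∈ K with i.2.2 = 2, (M k ρ c).real {ω | ω ∪
        edgeOf '' {vd : Site 2 × Fin 2 | ax k vd ∧ tb k vd = i.1 ∧ vd.2 = i.2.1} ∈ Aloc m F η ∧ ω \
        edgeOf '' {vd : Site 2 × Fin 2 | ax k vd ∧ tb k vd = i.1 ∧ vd.2 = i.2.1} ∉ Aloc m F η} := by
    intro ρ c h
    -- abbreviations
    obtain ⟨Pv, hPv⟩ : ∃ Pv : Site 2 × Fin 2 × Fin 3 → ℝ, ∀ i, (M k ρ c).real {ω | ω ∪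
        edgeOf '' {vd : Site 2 × Fin 2 | ax k vd ∧ tb k vd = i.1 ∧ vd.2 = i.2.1} ∈ Aloc m F η ∧ ω \
        edgeOf '' {vd : Site 2 × Fin 2 | ax k vd ∧ tb k vd = i.1 ∧ vd.2 = i.2.1} ∉ Aloc m F η} = Pv i :=
      ⟨_, fun _ => rfl⟩
    obtain ⟨Df, hDf⟩ : ∃ Df : Site 2 × Fin 2 × Fin 3 → ℝ, ∀ i,
        ∑ J ∈ ((Finset.range k).powerset).erase (Finset.range k), (M k ρ c).real
          ({ω | ω \ edgeOf '' {vd : Site 2 × Fin 2 | ax k vd ∧ tb k vd = i.1 ∧ vd.2 = i.2.1} ∪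
            ↑(J.image fun j : ℕ => edgeOf ((fun l => (k : ℤ) * i.1 l + if l = i.2.1 then (j : ℤ) else 0),
              i.2.1)) ∈ Aloc m F η} \ {ω | ω \ edgeOf '' {vd : Site 2 × Fin 2 | ax k vd ∧ tb k vd = i.1 ∧
            vd.2 = i.2.1} ∈ Aloc m F η}) = Df i := ⟨_, fun _ => rfl⟩
    have hDle : ∀ i, Df i ≤ (2 ^ k - 2) * Pv i := fun i => by
      rw [← hDf, ← hPv]
      exact sum_erase_real_section_sdiff_le hkpos m F η ρ c i.1 i.2.1
    have hPv0 : ∀ i, 0 ≤ Pv i := fun i => by rw [← hPv]; exact measureReal_nonneg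
    simp only [hPv, hDf] at h ⊢
    have hN : 0 ≤ ∑ i ∈ K with i.2.2 = 2, Pv i := Finset.sum_nonneg fun i _ => hPv0 i
    have hθN : ∑ i ∈ S, Pv i ≤ max θ 0 * ∑ i ∈ K with i.2.2 = 2, Pv i :=
      h.trans (mul_le_mul_of_nonneg_right (le_max_left _ _) hN)
    have hL : ∑ i ∈ S, Df i ≤ (2 ^ k - 2) * ∑ i ∈ S, Pv i := by
      rw [Finset.mul_sum]
      exact Finset.sum_le_sum fun i _ => hDle i
    have hp : (0 : ℝ) ≤ (1 / 2) ^ k := by positivity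
    calc (1 / 2 : ℝ) ^ k * ∑ i ∈ S, Df i ≤ (1 / 2) ^ k * ((2 ^ k - 2) * ∑ i ∈ S, Pv i) :=
          mul_le_mul_of_nonneg_left hL hp
      _ = (1 - 2 * (1 / 2) ^ k) * ∑ i ∈ S, Pv i := by rw [← mul_assoc, hpk]
      _ ≤ (1 - 2 * (1 / 2) ^ k) * (max θ 0 * ∑ i ∈ K with i.2.2 = 2, Pv i) :=
          mul_le_mul_of_nonneg_left hθN (by linarith)
      _ = (1 - 2 * (1 / 2) ^ k) * max θ 0 * ∑ i ∈ K with i.2.2 = 2, Pv i := by ring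
  exact ⟨fun ρ hρ hband => key ρ 0 (Hb ρ hρ hband), key 1 0 Hc⟩

/-- **(D0) ⟹ (D0∂)** (the converse of the registered reduction, recorded to certify that (D0∂) loses
nothing): from `2^{-k} T ≤ θ N` and `T = N + T′ ≥ N + T′_S` get `2^{-k} T′_S ≤ (θ − 2^{-k}) N` for every
set `S` of selector coins of the window; nearness of `S` is not even used. -/
theorem boundaryDefectBound_c0_of_defectBound : (∀ k : ℕ, k = 2 ∨ k = 3 → ∀ (m : ℕ) (F : Fin m → Quad (Set.univ : Set ℂ)), 0 < m → ∀ vlo vhi : ℝ, 0 < vlo → vlo < vhi → vhi < 1 → ∃ θ η₁ : ℝ, θ < 1 / 2 ∧ 0 < η₁ ∧ ∀ η ∈ Set.Ioo 0 η₁, ∀ K : Finset (Site 2 × Fin 2 × Fin 3), (↑K : Set (Site 2 × Fin 2 × Fin 3)) = coinWindow k (window m F η) → (∀ ρ ∈ Set.Icc (0 : ℝ) 1, P k m F η ρ 0 ∈ Set.Icc vlo vhi → (1 / 2) ^ k * ∑ i ∈ K with i.2.2 = 2, ∑ J ∈ (Finset.range k).powerset, (M k ρ 0).real ({ω | ω \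 edgeOf '' {vd : Site 2 × Fin 2 | ax k vd ∧ tb k vd = i.1 ∧ vd.2 = i.2.1} ∪ ↑(J.image fun j : ℕ => edgeOf ((fun l => (k : ℤ) * i.1 l + if l = i.2.1 then (j : ℤ) else 0), i.2.1)) ∈ Aloc m F η} \ {ω | ω \ edgeOf '' {vd : Site 2 × Fin 2 | ax k vd ∧ tb k vd = i.1 ∧ vd.2 = i.2.1} ∈ Aloc m F η}) ≤ θ * ∑ i ∈ K with i.2.2 = 2, (M k ρ 0).real {ω | ω ∪ edgeOf '' {vd : Site 2 × Fin 2 | ax k vd ∧ tb k vd = i.1 ∧ vd.2 = i.2.1} ∈ Aloc m F η ∧ ω \ edgeOf '' {vd : Site 2 × Fin 2 | ax k vd ∧ tb k vd = i.1 ∧ vd.2 = i.2.1} ∉ Aloc m F η}) ∧ (1 / 2) ^ k * ∑ i ∈ K with i.2.2 = 2, ∑ J ∈ (Finset.range k).powerset, (M k 1 0).real ({ω | ω \ edgeOf '' {vd : Site 2 × Fin 2 | ax k vd ∧ tb k vd = i.1 ∧ vd.2 = i.2.1} ∪ ↑(J.image fun j : ℕ => edgeOf ((fun l => (k : ℤ)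 * i.1 l + if l = i.2.1 then (j : ℤ) else 0), i.2.1)) ∈ Aloc m F η} \ {ω | ω \ edgeOf '' {vd : Site 2 × Fin 2 | ax k vd ∧ tb k vd = i.1 ∧ vd.2 = i.2.1} ∈ Aloc m F η}) ≤ θ * ∑ i ∈ K with i.2.2 = 2, (M k 1 0).real {ω | ω ∪ edgeOf '' {vd : Site 2 × Fin 2 | ax k vd ∧ tb k vd = i.1 ∧ vd.2 = i.2.1} ∈ Aloc m F η ∧ ω \ edgeOf '' {vd : Site 2 × Fin 2 | ax k vd ∧ tb k vd = i.1 ∧ vd.2 = i.2.1} ∉ Aloc m F η}) → ∀ k : ℕ, k = 2 ∨ k = 3 → ∀ (m : ℕ) (F : Fin m → Quad (Set.univ : Set ℂ)), 0 < m → ∀ vlo vhi : ℝ, 0 < vlo → vlo < vhi → vhi < 1 → ∃ θ η₁ : ℝ, θ < 1 / 2 - (1 / 2) ^ k ∧ 0 < η₁ ∧ ∀ η ∈ Set.Ioo 0 η₁, ∀ K : Finset (Site 2 × Fin 2 × Fin 3), (↑K : Set (Site 2 × Fin 2 × Fin 3)) = coinWindow k (window m F η) → ∀ S : Finset (Site 2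 × Fin 2 × Fin 3), S ⊆ K.filter (fun i => i.2.2 = 2) → (∀ i ∈ S, ∃ j : ℕ, j ≤ k ∧ ∃ (a : Fin m) (b : Fin 4), ∃ q ∈ (F a).side b, dist ((η : ℂ) * squareLatticeEmbedding.z (fun l => (k : ℤ) * i.1 l + if l = i.2.1 then (j : ℤ) else 0)) q < 2 * η) → (∀ ρ ∈ Set.Icc (0 : ℝ) 1, P k m F η ρ 0 ∈ Set.Icc vlo vhi → (1 / 2) ^ k * ∑ i ∈ S, ∑ J ∈ ((Finset.range k).powerset).erase (Finset.range k), (M k ρ 0).real ({ω | ω \ edgeOf '' {vd : Site 2 × Fin 2 | ax k vd ∧ tb k vd = i.1 ∧ vd.2 = i.2.1} ∪ ↑(J.image fun j : ℕ => edgeOf ((fun l => (k : ℤ) * i.1 l + if l = i.2.1 then (j : ℤ) else 0), i.2.1)) ∈ Aloc m F η} \ {ω | ω \ edgeOf '' {vd : Site 2 × Fin 2 | ax k vd ∧ tb k vd = i.1 ∧ vd.2 = i.2.1} ∈ Aloc m F η}) ≤ θ * ∑ i ∈ K with i.2.2 = 2, (M k ρ 0).real {ω | ω ∪ edgeOf ''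 {vd : Site 2 × Fin 2 | ax k vd ∧ tb k vd = i.1 ∧ vd.2 = i.2.1} ∈ Aloc m F η ∧ ω \ edgeOf '' {vd : Site 2 × Fin 2 | ax k vd ∧ tb k vd = i.1 ∧ vd.2 = i.2.1} ∉ Aloc m F η}) ∧ (1 / 2) ^ k * ∑ i ∈ S, ∑ J ∈ ((Finset.range k).powerset).erase (Finset.range k), (M k 1 0).real ({ω | ω \ edgeOf '' {vd : Site 2 × Fin 2 | ax k vd ∧ tb k vd = i.1 ∧ vd.2 = i.2.1} ∪ ↑(J.image fun j : ℕ => edgeOf ((fun l => (k : ℤ) * i.1 l + if l = i.2.1 then (j : ℤ) else 0), i.2.1)) ∈ Aloc m F η} \ {ω | ω \ edgeOf '' {vd : Site 2 × Fin 2 | ax k vd ∧ tb k vd = i.1 ∧ vd.2 = i.2.1} ∈ Aloc m F η}) ≤ θ * ∑ i ∈ K with i.2.2 = 2, (M k 1 0).real {ω | ω ∪ edgeOf '' {vd : Site 2 × Fin 2 | ax k vd ∧ tb k vd = i.1 ∧ vd.2 = i.2.1} ∈ Aloc m F η ∧ ω \ edgeOf '' {vd : Site 2 × Fin 2 | ax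 k vd ∧ tb k vd = i.1 ∧ vd.2 = i.2.1} ∉ Aloc m F η} := by
  intro H k hk m F hm vlo vhi hvlo hvv hvhi
  have hkpos : 0 < k := by rcases hk with rfl | rfl <;> norm_num
  obtain ⟨θ, η₁, hθ, hη₁, Hθ⟩ := H k hk m F hm vlo vhi hvlo hvv hvhi
  refine ⟨θ - (1 / 2) ^ k, η₁, by linarith, hη₁, fun η hη K hK S hS _ => ?_⟩
  obtain ⟨Hb, Hc⟩ := Hθ η hη K hK
  -- the real-inequality core, at one parameter point `(ρ, c)`
  have key : ∀ ρ c : ℝ, (1 / 2) ^ k * ∑ i ∈ K with i.2.2 = 2, ∑ J ∈ (Finset.range k).powerset,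
      (M k ρ c).real ({ω | ω \ edgeOf '' {vd : Site 2 × Fin 2 | ax k vd ∧ tb k vd = i.1 ∧ vd.2 = i.2.1} ∪
        ↑(J.image fun j : ℕ => edgeOf ((fun l => (k : ℤ) * i.1 l + if l = i.2.1 then (j : ℤ) else 0),
          i.2.1)) ∈ Aloc m F η} \ {ω | ω \ edgeOf '' {vd : Site 2 × Fin 2 | ax k vd ∧ tb k vd = i.1 ∧
        vd.2 = i.2.1} ∈ Aloc m F η}) ≤ θ * ∑ i ∈ K with i.2.2 = 2, (M k ρ c).real {ω | ω ∪
      edgeOf '' {vd : Site 2 × Fin 2 | ax k vd ∧ tb k vd = i.1 ∧ vd.2 = i.2.1} ∈ Aloc m F η ∧ ω \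
      edgeOf '' {vd : Site 2 × Fin 2 | ax k vd ∧ tb k vd = i.1 ∧ vd.2 = i.2.1} ∉ Aloc m F η} →
      (1 / 2) ^ k * ∑ i ∈ S, ∑ J ∈ ((Finset.range k).powerset).erase (Finset.range k), (M k ρ c).real
        ({ω | ω \ edgeOf '' {vd : Site 2 × Fin 2 | ax k vd ∧ tb k vd = i.1 ∧ vd.2 = i.2.1} ∪
          ↑(J.image fun j : ℕ => edgeOf ((fun l => (k : ℤ) * i.1 l + if l = i.2.1 then (j : ℤ) else 0),
            i.2.1)) ∈ Aloc m F η} \ {ω | ω \ edgeOf '' {vd : Site 2 × Fin 2 | ax k vd ∧ tb k vd = i.1 ∧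
          vd.2 = i.2.1} ∈ Aloc m F η}) ≤
      (θ - (1 / 2) ^ k) * ∑ i ∈ K with i.2.2 = 2, (M k ρ c).real {ω | ω ∪
        edgeOf '' {vd : Site 2 × Fin 2 | ax k vd ∧ tb k vd = i.1 ∧ vd.2 = i.2.1} ∈ Aloc m F η ∧ ω \
        edgeOf '' {vd : Site 2 × Fin 2 | ax k vd ∧ tb k vd = i.1 ∧ vd.2 = i.2.1} ∉ Aloc m F η} := by
    intro ρ c h
    rw [sum_sum_powerset_eq_pivotal_add_proper hkpos m F η ρ c] at h
    -- abbreviations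
    obtain ⟨Pv, hPv⟩ : ∃ Pv : Site 2 × Fin 2 × Fin 3 → ℝ, ∀ i, (M k ρ c).real {ω | ω ∪
        edgeOf '' {vd : Site 2 × Fin 2 | ax k vd ∧ tb k vd = i.1 ∧ vd.2 = i.2.1} ∈ Aloc m F η ∧ ω \
        edgeOf '' {vd : Site 2 × Fin 2 | ax k vd ∧ tb k vd = i.1 ∧ vd.2 = i.2.1} ∉ Aloc m F η} = Pv i :=
      ⟨_, fun _ => rfl⟩
    obtain ⟨Df, hDf⟩ : ∃ Df : Site 2 × Fin 2 × Fin 3 → ℝ, ∀ i,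
        ∑ J ∈ ((Finset.range k).powerset).erase (Finset.range k), (M k ρ c).real
          ({ω | ω \ edgeOf '' {vd : Site 2 × Fin 2 | ax k vd ∧ tb k vd = i.1 ∧ vd.2 = i.2.1} ∪
            ↑(J.image fun j : ℕ => edgeOf ((fun l => (k : ℤ) * i.1 l + if l = i.2.1 then (j : ℤ) else 0),
              i.2.1)) ∈ Aloc m F η} \ {ω | ω \ edgeOf '' {vd : Site 2 × Fin 2 | ax k vd ∧ tb k vd = i.1 ∧
            vd.2 = i.2.1} ∈ Aloc m F η}) = Df i := ⟨_, fun _ => rfl⟩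
    have hDf0 : ∀ i, 0 ≤ Df i := fun i => by
      rw [← hDf]; exact Finset.sum_nonneg fun J _ => measureReal_nonneg
    simp only [hPv, hDf] at h ⊢
    have hsub : ∑ i ∈ S, Df i ≤ ∑ i ∈ K with i.2.2 = 2, Df i :=
      Finset.sum_le_sum_of_subset_of_nonneg hS fun i _ _ => hDf0 i
    have hp : (0 : ℝ) ≤ (1 / 2) ^ k := by positivity
    nlinarith [mul_le_mul_of_nonneg_left hsub hp]
  exact ⟨fun ρ hρ hband => key ρ 0 (Hb ρ hρ hband), key 1 0 Hc⟩

/-- **(D0∂) ⟹ (D0)** (registered reduction of `stub_cornerWindows`, wave 5): hypothesis (D0) of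
`cornerWindow_c0_of_pivotalWindow_of_defectBound` — on the slice `c = 0`, at the band points and at the
corner, `2^{-k} Σ_B Σ_{J ⊆ [k]} M(A_B^J ∖ A_B^∅) ≤ θ · Σ_B M(B set-pivotal)` with `θ < ½` — FOLLOWS from its
boundary-layer form (D0∂): the same inequality with the double sum restricted to the PROPER patterns
`J ⊊ [k]` of the NEAR bundles (a canonical vertex `k•t + j e_d`, `j ≤ k`, within drawn distance `2η` of a
side of a quad; any finite set `S` of such selector coins) and `θ′ < ½ − 2^{-k}`.  Proof: `T = N + T′`
bundle by bundle, and by brick S2 (`real_section_sdiff_eq_zero_of_far_c0`, radius `2η`) the proper terms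
of the far bundles vanish on `{c = 0}`, so `2^{-k} T = 2^{-k} N + 2^{-k} T′_near ≤ (2^{-k} + θ′) N`. -/
theorem defectBound_c0_of_boundaryDefectBound : (∀ k : ℕ, k = 2 ∨ k = 3 → ∀ (m : ℕ) (F : Fin m → Quad (Set.univ : Set ℂ)), 0 < m → ∀ vlo vhi : ℝ, 0 < vlo → vlo < vhi → vhi < 1 → ∃ θ η₁ : ℝ, θ < 1 / 2 - (1 / 2) ^ k ∧ 0 < η₁ ∧ ∀ η ∈ Set.Ioo 0 η₁, ∀ K : Finset (Site 2 × Fin 2 × Fin 3), (↑K : Set (Site 2 × Fin 2 × Fin 3)) = coinWindow k (window m F η) → ∀ S : Finset (Site 2 × Fin 2 × Fin 3), S ⊆ K.filter (fun i => i.2.2 = 2) → (∀ i ∈ S, ∃ j : ℕ, j ≤ k ∧ ∃ (a : Fin m) (b : Fin 4), ∃ q ∈ (F a).side b, dist ((η : ℂ) * squareLatticeEmbedding.z (fun l => (k : ℤ) * i.1 l + if l = i.2.1 then (j : ℤ) else 0)) q < 2 * η) → (∀ ρ ∈ Set.Icc (0 : ℝ) 1, P k m F η ρ 0 ∈ Set.Icc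 vlo vhi → (1 / 2) ^ k * ∑ i ∈ S, ∑ J ∈ ((Finset.range k).powerset).erase (Finset.range k), (M k ρ 0).real ({ω | ω \ edgeOf '' {vd : Site 2 × Fin 2 | ax k vd ∧ tb k vd = i.1 ∧ vd.2 = i.2.1} ∪ ↑(J.image fun j : ℕ => edgeOf ((fun l => (k : ℤ) * i.1 l + if l = i.2.1 then (j : ℤ) else 0), i.2.1)) ∈ Aloc m F η} \ {ω | ω \ edgeOf '' {vd : Site 2 × Fin 2 | ax k vd ∧ tb k vd = i.1 ∧ vd.2 = i.2.1} ∈ Aloc m F η}) ≤ θ * ∑ i ∈ K with i.2.2 = 2, (M k ρ 0).real {ω | ω ∪ edgeOf '' {vd : Site 2 × Fin 2 | ax k vd ∧ tb k vd = i.1 ∧ vd.2 = i.2.1} ∈ Aloc m F η ∧ ω \ edgeOf '' {vd : Site 2 × Fin 2 | ax k vd ∧ tb k vd = i.1 ∧ vd.2 = i.2.1} ∉ Aloc m F η}) ∧ (1 / 2) ^ k * ∑ i ∈ S, ∑ J ∈ ((Finset.range k).powerset).erase (Finset.range k), (M k 1 0).real ({ω | ω \ edgeOf '' {vd : Site 2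 × Fin 2 | ax k vd ∧ tb k vd = i.1 ∧ vd.2 = i.2.1} ∪ ↑(J.image fun j : ℕ => edgeOf ((fun l => (k : ℤ) * i.1 l + if l = i.2.1 then (j : ℤ) else 0), i.2.1)) ∈ Aloc m F η} \ {ω | ω \ edgeOf '' {vd : Site 2 × Fin 2 | ax k vd ∧ tb k vd = i.1 ∧ vd.2 = i.2.1} ∈ Aloc m F η}) ≤ θ * ∑ i ∈ K with i.2.2 = 2, (M k 1 0).real {ω | ω ∪ edgeOf '' {vd : Site 2 × Fin 2 | ax k vd ∧ tb k vd = i.1 ∧ vd.2 = i.2.1} ∈ Aloc m F η ∧ ω \ edgeOf '' {vd : Site 2 × Fin 2 | ax k vd ∧ tb k vd = i.1 ∧ vd.2 = i.2.1} ∉ Aloc m F η}) → ∀ k : ℕ, k = 2 ∨ k = 3 → ∀ (m : ℕ) (F : Fin m → Quad (Set.univ : Set ℂ)), 0 < m → ∀ vlo vhi : ℝ, 0 < vlo → vlo < vhi → vhi < 1 → ∃ θ η₁ : ℝ, θ < 1 / 2 ∧ 0 < η₁ ∧ ∀ η ∈ Set.Ioo 0 η₁, ∀ K : Finset (Site 2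 × Fin 2 × Fin 3), (↑K : Set (Site 2 × Fin 2 × Fin 3)) = coinWindow k (window m F η) → (∀ ρ ∈ Set.Icc (0 : ℝ) 1, P k m F η ρ 0 ∈ Set.Icc vlo vhi → (1 / 2) ^ k * ∑ i ∈ K with i.2.2 = 2, ∑ J ∈ (Finset.range k).powerset, (M k ρ 0).real ({ω | ω \ edgeOf '' {vd : Site 2 × Fin 2 | ax k vd ∧ tb k vd = i.1 ∧ vd.2 = i.2.1} ∪ ↑(J.image fun j : ℕ => edgeOf ((fun l => (k : ℤ) * i.1 l + if l = i.2.1 then (j : ℤ) else 0), i.2.1)) ∈ Aloc m F η} \ {ω | ω \ edgeOf '' {vd : Site 2 × Fin 2 | ax k vd ∧ tb k vd = i.1 ∧ vd.2 = i.2.1} ∈ Aloc m F η}) ≤ θ * ∑ i ∈ K with i.2.2 = 2, (M k ρ 0).real {ω | ω ∪ edgeOf '' {vd : Site 2 × Fin 2 | ax k vd ∧ tb k vd = i.1 ∧ vd.2 = i.2.1} ∈ Aloc m F η ∧ ω \ edgeOf '' {vd : Site 2 × Fin 2 | ax k vd ∧ tb k vd = i.1 ∧ vd.2 = i.2.1}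 ∉ Aloc m F η}) ∧ (1 / 2) ^ k * ∑ i ∈ K with i.2.2 = 2, ∑ J ∈ (Finset.range k).powerset, (M k 1 0).real ({ω | ω \ edgeOf '' {vd : Site 2 × Fin 2 | ax k vd ∧ tb k vd = i.1 ∧ vd.2 = i.2.1} ∪ ↑(J.image fun j : ℕ => edgeOf ((fun l => (k : ℤ) * i.1 l + if l = i.2.1 then (j : ℤ) else 0), i.2.1)) ∈ Aloc m F η} \ {ω | ω \ edgeOf '' {vd : Site 2 × Fin 2 | ax k vd ∧ tb k vd = i.1 ∧ vd.2 = i.2.1} ∈ Aloc m F η}) ≤ θ * ∑ i ∈ K with i.2.2 = 2, (M k 1 0).real {ω | ω ∪ edgeOf '' {vd : Site 2 × Fin 2 | ax k vd ∧ tb k vd = i.1 ∧ vd.2 = i.2.1} ∈ Aloc m F η ∧ ω \ edgeOf '' {vd : Site 2 × Fin 2 | ax k vd ∧ tb k vd = i.1 ∧ vd.2 = i.2.1} ∉ Aloc m F η} := by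
  intro H k hk m F hm vlo vhi hvlo hvv hvhi
  classical
  have hkpos : 0 < k := by rcases hk with rfl | rfl <;> norm_num
  obtain ⟨θ, η₁, hθ, hη₁, Hθ⟩ := H k hk m F hm vlo vhi hvlo hvv hvhi
  refine ⟨θ + (1 / 2) ^ k, η₁, by linarith, hη₁, fun η hη K hK => ?_⟩
  have hη0 : 0 < η := hη.1
  -- the layer: the near selector coins of the window
  obtain ⟨S, hS_def⟩ : ∃ S : Finset (Site 2 × Fin 2 × Fin 3), S = (K.filter fun i => i.2.2 = 2).filter
      fun i => ∃ j : ℕ, j ≤ k ∧ ∃ (a : Fin m) (b : Fin 4), ∃ q ∈ (F a).side b,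
        dist ((η : ℂ) * squareLatticeEmbedding.z
          (fun l => (k : ℤ) * i.1 l + if l = i.2.1 then (j : ℤ) else 0)) q < 2 * η := ⟨_, rfl⟩
  have hSsub : S ⊆ K.filter fun i => i.2.2 = 2 := by
    rw [hS_def]; exact Finset.filter_subset _ _
  have hSnear : ∀ i ∈ S, ∃ j : ℕ, j ≤ k ∧ ∃ (a : Fin m) (b : Fin 4), ∃ q ∈ (F a).side b,
      dist ((η : ℂ) * squareLatticeEmbedding.z
        (fun l => (k : ℤ) * i.1 l + if l = i.2.1 then (j : ℤ) else 0)) q < 2 * η := fun i hi => by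
    rw [hS_def] at hi
    exact (Finset.mem_filter.1 hi).2
  have hfar : ∀ i ∈ K.filter (fun i => i.2.2 = 2), i ∉ S → ∀ j : ℕ, j ≤ k → ∀ (a : Fin m) (b : Fin 4),
      ∀ q ∈ (F a).side b, 2 * η ≤ dist ((η : ℂ) * squareLatticeEmbedding.z
        (fun l => (k : ℤ) * i.1 l + if l = i.2.1 then (j : ℤ) else 0)) q := by
    intro i hi hiS j hj a b q hq
    by_contra hlt
    refine hiS ?_
    rw [hS_def]
    exact Finset.mem_filter.2 ⟨hi, j, hj, a, b, q, hq, not_le.1 hlt⟩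
  obtain ⟨Hb, Hc⟩ := Hθ η hη K hK S hSsub hSnear
  constructor
  · intro ρ hρ hband
    have h := Hb ρ hρ hband
    rw [sum_sum_powerset_eq_of_far_c0 hkpos F hη0 ρ hSsub hfar]
    linarith
  · rw [sum_sum_powerset_eq_of_far_c0 hkpos F hη0 1 hSsub hfar]
    linarith

end Summit.CriticalPhenomena.CardyFormulaZ2.Theorems.CardySelfRefinement

end
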